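/-
Copyright (c) 2026. All rights reserved.
Released under Apache 2.0 license as described in the file LICENSE.
-/
import Literature.NumberTheory.GaloisRepresentations.LabelledWeightsFramedBlockSum
import Literature.NumberTheory.GaloisRepresentations.LabelledHodgeFiltration
import Literature.NumberTheory.GaloisRepresentations.LabelledWeightsDeRhamRank
import HarnessLib

/-!
# Labelled Hodge–Tate weights of a block-triangular representation: `HT_τ(ρ) = HT_τ(ρ₁) + HT_τ(ρ₂)`

Topic `NumberTheory/GaloisRepresentations`; theorems only (no definition, no named fact, no
`sorry`).  For EVERY period-ring datum `𝔅` over `P ⊆ F` (intended `B_dR(F)`), coefficients `E` and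
label `τ : F → E`:

* §1 `finrank_labelFilD_eq_card_filter` — `dim_E Fil^i D_τ(ρ) = #{h ∈ HT_τ(ρ) : i ≤ h}` (adapted
  bases, accepted `exists_basis_labelD_adapted`), and the **duality count**
  `finrank_labelFilD_add_finrank_labelFilD_of_eq_map_neg`: if `HT_τ(ρ') = −HT_τ(ρ)` (e.g. `ρ' = ρ^∨`,
  accepted `PeriodRingData.labelledHodgeTateWeights_dual`) then
  `dim Fil^{1-i} D_τ(ρ') + dim Fil^i D_τ(ρ) = dim D_τ(ρ)`.
* §2 `finrank_labelFilD_le_add_of_exact` — **left exactness of `Fil^i D_τ`**: for `Γ`-equivariant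
  `E`-linear `f : V₁ → V`, `g : V → V₂` with an `E`-linear (not necessarily equivariant) splitting
  `r : V → V₁`, `s : V₂ → V` (`r f = 1`, `f r + s g = 1`):
  `dim Fil^i D_τ(V) ≤ dim Fil^i D_τ(V₁) + dim Fil^i D_τ(V₂)` (the kernel of `Fil^i D_τ(g ⊗ 1)` is
  carried injectively into `Fil^i D_τ(V₁)` by `r ⊗ 1`).
* §3 `labelledHodgeTateWeights_eq_add_of_exact_of_dual` — if moreover the "dual" triple
  `(V₂', V', V₁')` is exact in the same sense, `HT_τ(V') = −HT_τ(V)`, `HT_τ(Vᵢ') = −HT_τ(Vᵢ)` and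
  `dim D_τ(V) = dim D_τ(V₁) + dim D_τ(V₂)`, then `dim Fil^i D_τ(V) = dim Fil^i D_τ(V₁) + dim Fil^i D_τ(V₂)`
  for all `i` and **`HT_τ(V) = HT_τ(V₁) + HT_τ(V₂)`** (multiset sum): the two left-exactness
  inequalities, for the triple and for its dual at `1 - i`, are opposite.
* §4 `labelledHodgeTateWeights_blockTriangular` — the framed form: `ρ : Γ →ₜ* GL_{m+n}(E)` block
  upper-triangular, `ρ(g) = reindex (fromBlocks ρ₁(g) X(g) 0 ρ₂(g))`; then `ρ^∨` is block
  lower-triangular with diagonal blocks `ρ₁^∨, ρ₂^∨` (`coe_dual_apply_of_blockTriangular`), and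
  `HT_τ(ρ) = HT_τ(ρ₁) + HT_τ(ρ₂)` as soon as the six label components are finite-dimensional,
  `dim D_τ(ρ) = dim D_τ(ρ₁) + dim D_τ(ρ₂)` and the three duals have negated weights — all of which
  hold for de Rham `ρ` and `B_dR` (pinned discharge in `PAdicHodge/LabelledWeightsBlockTriangularProofs`).

This is the weight-level reading of "`D_dR` is exact on short exact sequences of de Rham
representations, with strict morphisms" (Fontaine, Exp. III Prop. 1.5.2; Brinon–Conrad Prop. 6.3.3),
obtained here without Tate–Sen theory from left exactness and `HT(ρ^∨) = −HT(ρ)`.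

## References
* [FontaineAsterisque223III] J.-M. Fontaine, *Représentations p-adiques semi-stables*, Astérisque 223
  (1994), Exp. III §1.5, Prop. 1.5.2.
* [BrinonConrad2009] O. Brinon, B. Conrad, *CMI Summer School notes on p-adic Hodge theory* (2009),
  §6.3.
* [Patrikis2019] S. Patrikis, *Variations on a theorem of Tate*, Mem. AMS 258 (2019), §2.3.1.
-/

noncomputable section

open scoped TensorProduct
open TensorProduct Field

namespace Literature.NumberTheory.GaloisRepresentations

universe u v v' w

namespace PeriodRingData

-- Mathlib's own global value of `maxSynthPendingDepth` (nested instance problems on `M ⊗[P] 𝔅.B`).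
set_option maxSynthPendingDepth 3

/-! ### §1 Counting: `dim Fil^i D_τ = #{h ∈ HT_τ : i ≤ h}` and the duality count -/

section Count

variable {Γ : Type u} [Group Γ] [TopologicalSpace Γ] {P : Type v} {F : Type v'} [Field P]
  [Field F] [Algebra P F]
  {E : Type*} [Field E] [Algebra P E] [TopologicalSpace E]
  {M : Type*} [AddCommGroup M] [Module E M] [Module P M] [IsScalarTower P E M]
  [TopologicalSpace M]
  {M' : Type*} [AddCommGroup M'] [Module E M'] [Module P M'] [IsScalarTower P E M']
  [TopologicalSpace M']
  (𝔅 : PeriodRingData.{u, v, v', w} Γ P F) (ρ : ContinuousRep Γ E M) (ρ' : ContinuousRep Γ E M')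

/-- **`dim_E Fil^i D_τ(ρ) = #{h ∈ HT_τ(ρ) : i ≤ h}`** (with multiplicity) for `D_τ(ρ)`
finite-dimensional: read on a basis adapted to the Hodge filtration.
[cite: Patrikis2019, §2.3.1] [cite: Wach1996, §B.2.3, proof of Prop. 2 (p. 394)] -/
theorem finrank_labelFilD_eq_card_filter (τ : F →+* E) [FiniteDimensional E (𝔅.labelD ρ τ)]
    (i : ℤ) :
    Module.finrank E (𝔅.labelFilD ρ τ i) =
      Multiset.card ((𝔅.labelledHodgeTateWeights ρ τ).filter fun h => i ≤ h) := by
  classical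
  obtain ⟨m, d, h, -, hiff⟩ := 𝔅.exists_basis_labelD_adapted ρ τ
  rw [finrank_labelFilD_eq_card d h hiff i, labelledHodgeTateWeights_eq_map d h hiff,
    Multiset.filter_map, Multiset.card_map, ← Finset.filter_val, Finset.card_val]
  rfl

/-- **Duality count.**  If `HT_τ(ρ') = {−h : h ∈ HT_τ(ρ)}` (e.g. `ρ' = ρ^∨`, accepted
`PeriodRingData.labelledHodgeTateWeights_dual`) and both label components are finite-dimensional,
then `dim Fil^{1-i} D_τ(ρ') + dim Fil^i D_τ(ρ) = dim D_τ(ρ)` for every `i`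
(`#{h : 1 - i ≤ -h} + #{h : i ≤ h} = #HT_τ(ρ)`).
[cite: FontaineAsterisque223III, Exp. III §1.5, Prop. 1.5.2] [cite: BrinonConrad2009, §6.3] -/
theorem finrank_labelFilD_add_finrank_labelFilD_of_eq_map_neg (τ : F →+* E)
    [FiniteDimensional E (𝔅.labelD ρ τ)] [FiniteDimensional E (𝔅.labelD ρ' τ)]
    (hneg : 𝔅.labelledHodgeTateWeights ρ' τ = (𝔅.labelledHodgeTateWeights ρ τ).map fun h => -h)
    (i : ℤ) :
    Module.finrank E (𝔅.labelFilD ρ' τ (1 - i)) + Module.finrank E (𝔅.labelFilD ρ τ i) =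
      Module.finrank E (𝔅.labelD ρ τ) := by
  classical
  rw [𝔅.finrank_labelFilD_eq_card_filter ρ' τ, 𝔅.finrank_labelFilD_eq_card_filter ρ τ, hneg,
    Multiset.filter_map, Multiset.card_map, ← 𝔅.card_labelledHodgeTateWeights_eq_finrank ρ τ]
  set S := 𝔅.labelledHodgeTateWeights ρ τ
  have hS : S.filter ((fun h : ℤ => 1 - i ≤ h) ∘ fun h => -h) = S.filter fun h => ¬ i ≤ h :=
    Multiset.filter_congr fun h _ => by
      simp only [Function.comp_apply, not_le]
      omega
  rw [hS, add_comm, ← Multiset.card_add, Multiset.filter_add_not]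

end Count

/-! ### §2 Left exactness of `Fil^i D_τ` -/

section LeftExact

variable {Γ : Type u} [Group Γ] [TopologicalSpace Γ] {P : Type v} {F : Type v'} [Field P]
  [Field F] [Algebra P F]
  {E : Type*} [Field E] [Algebra P E] [TopologicalSpace E]
  {M₁ : Type*} [AddCommGroup M₁] [Module E M₁] [Module P M₁] [IsScalarTower P E M₁]
  [TopologicalSpace M₁]
  {M : Type*} [AddCommGroup M] [Module E M] [Module P M] [IsScalarTower P E M]
  [TopologicalSpace M]
  {M₂ : Type*} [AddCommGroup M₂] [Module E M₂] [Module P M₂] [IsScalarTower P E M₂]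
  [TopologicalSpace M₂]
  (𝔅 : PeriodRingData.{u, v, v', w} Γ P F) (ρ₁ : ContinuousRep Γ E M₁) (ρ : ContinuousRep Γ E M)
  (ρ₂ : ContinuousRep Γ E M₂)

/-- **Left exactness of `Fil^i D_τ` on a short exact sequence `0 → V₁ → V → V₂ → 0`** given by
`Γ`-equivariant `E`-linear `f : V₁ → V`, `g : V → V₂` and an `E`-linear splitting `r : V → V₁`,
`s : V₂ → V` (`r ∘ f = 1`, `f ∘ r + s ∘ g = 1`; the splitting need not be equivariant):
`dim_E Fil^i D_τ(V) ≤ dim_E Fil^i D_τ(V₁) + dim_E Fil^i D_τ(V₂)`.  Proof: `g ⊗ 1` maps `Fil^i D_τ(V)`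
to `Fil^i D_τ(V₂)`; on its kernel, `r ⊗ 1` is injective with values in `Fil^i D_τ(V₁)` (an element
`x` of the kernel is `(f ⊗ 1)(r ⊗ 1) x`, and `f ⊗ 1` is an equivariant, `F`-linear, filtered injection).
[cite: FontaineAsterisque223III, Exp. III §1.5, Prop. 1.5.2] [cite: BrinonConrad2009, §6.3] -/
theorem finrank_labelFilD_le_add_of_exact (f : M₁ →ₗ[E] M) (g : M →ₗ[E] M₂) (r : M →ₗ[E] M₁)
    (s : M₂ →ₗ[E] M)
    (hf : ∀ (σ : Γ) (y : M₁), f (ρ₁ σ y) = ρ σ (f y))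
    (hg : ∀ (σ : Γ) (x : M), g (ρ σ x) = ρ₂ σ (g x))
    (hrf : ∀ y, r (f y) = y) (hsum : ∀ x, f (r x) + s (g x) = x)
    (τ : F →+* E) (i : ℤ) [FiniteDimensional E (𝔅.labelD ρ τ)]
    [FiniteDimensional E (𝔅.labelD ρ₁ τ)] [FiniteDimensional E (𝔅.labelD ρ₂ τ)] :
    Module.finrank E (𝔅.labelFilD ρ τ i) ≤
      Module.finrank E (𝔅.labelFilD ρ₁ τ i) + Module.finrank E (𝔅.labelFilD ρ₂ τ i) := by
  haveI : FiniteDimensional E (𝔅.labelFilD ρ τ i) :=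
    Submodule.finiteDimensional_of_le (𝔅.labelFilD_le ρ τ i)
  haveI : FiniteDimensional E (𝔅.labelFilD ρ₁ τ i) :=
    Submodule.finiteDimensional_of_le (𝔅.labelFilD_le ρ₁ τ i)
  haveI : FiniteDimensional E (𝔅.labelFilD ρ₂ τ i) :=
    Submodule.finiteDimensional_of_le (𝔅.labelFilD_le ρ₂ τ i)
  let fB : M₁ ⊗[P] 𝔅.B →ₗ[E] M ⊗[P] 𝔅.B := AlgebraTensorModule.map f LinearMap.id
  let gB : M ⊗[P] 𝔅.B →ₗ[E] M₂ ⊗[P] 𝔅.B := AlgebraTensorModule.map g LinearMap.id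
  let rB : M ⊗[P] 𝔅.B →ₗ[E] M₁ ⊗[P] 𝔅.B := AlgebraTensorModule.map r LinearMap.id
  let sB : M₂ ⊗[P] 𝔅.B →ₗ[E] M ⊗[P] 𝔅.B := AlgebraTensorModule.map s LinearMap.id
  -- the splitting identities after `⊗ B`
  have hrfB : ∀ y : M₁ ⊗[P] 𝔅.B, rB (fB y) = y := fun y => by
    induction y using TensorProduct.induction_on with
    | zero => simp only [map_zero]
    | tmul m b => simp [rB, fB, hrf]
    | add x y hx hy => simp only [map_add, hx, hy]
  have hsumB : ∀ x : M ⊗[P] 𝔅.B, fB (rB x) + sB (gB x) = x := fun x => by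
    induction x using TensorProduct.induction_on with
    | zero => simp only [map_zero, add_zero]
    | tmul m b =>
      simp only [fB, rB, sB, gB, AlgebraTensorModule.map_tmul, LinearMap.id_apply]
      rw [← TensorProduct.add_tmul, hsum]
    | add x y hx hy =>
      simp only [map_add]
      calc fB (rB x) + fB (rB y) + (sB (gB x) + sB (gB y))
          = (fB (rB x) + sB (gB x)) + (fB (rB y) + sB (gB y)) := by abel
        _ = x + y := by rw [hx, hy]
  have hfBinj : Function.Injective fB :=
    Function.LeftInverse.injective (g := rB) hrfB
  -- `g ⊗ 1` restricted to `Fil^i D_τ(V)`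
  have hto : ∀ x : 𝔅.labelFilD ρ τ i, gB x ∈ 𝔅.labelFilD ρ₂ τ i := fun x =>
    𝔅.labelFilD_map_left ρ ρ₂ g hg τ x.2
  let G : 𝔅.labelFilD ρ τ i →ₗ[E] 𝔅.labelFilD ρ₂ τ i :=
    { toFun := fun x => ⟨gB x, hto x⟩
      map_add' := fun x y => Subtype.ext (by simp only [Submodule.coe_add, map_add])
      map_smul' := fun c x => Subtype.ext (by
        simp only [Submodule.coe_smul, map_smul, RingHom.id_apply]) }
  -- on `ker G`, `r ⊗ 1` lands in `Fil^i D_τ(V₁)`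
  have hker : ∀ x : LinearMap.ker G, rB ((x : 𝔅.labelFilD ρ τ i) : M ⊗[P] 𝔅.B) ∈ 𝔅.labelFilD ρ₁ τ i := by
    intro x
    have hx : ((x : 𝔅.labelFilD ρ τ i) : M ⊗[P] 𝔅.B) ∈ 𝔅.labelFilD ρ τ i := (x : 𝔅.labelFilD ρ τ i).2
    have hgx : gB ((x : 𝔅.labelFilD ρ τ i) : M ⊗[P] 𝔅.B) = 0 := by
      have := congrArg Subtype.val (LinearMap.mem_ker.1 x.2)
      exact this
    set z : M ⊗[P] 𝔅.B := ((x : 𝔅.labelFilD ρ τ i) : M ⊗[P] 𝔅.B) with hz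
    -- `z = (f ⊗ 1) ((r ⊗ 1) z)`
    have hzf : fB (rB z) = z := by
      have := hsumB z
      rwa [hgx, map_zero, add_zero] at this
    obtain ⟨hzD, hzFil⟩ := Submodule.mem_inf.1 hx
    obtain ⟨hzinv, hzlab⟩ := (𝔅.mem_labelD_iff ρ τ z).1 hzD
    refine Submodule.mem_inf.2 ⟨(𝔅.mem_labelD_iff ρ₁ τ _).2 ⟨(𝔅.mem_coeffD_iff ρ₁ _).2 fun σ => ?_,
      fun a => ?_⟩, 𝔅.coeffFilTensor_map_left r hzFil⟩
    · -- invariance, tested after the injection `f ⊗ 1`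
      apply hfBinj
      rw [𝔅.coeffTensorRep_map_left ρ₁ ρ f hf σ, hzf]
      exact (𝔅.mem_coeffD_iff ρ z).1 hzinv σ
    · apply hfBinj
      rw [𝔅.baseAct_map_left, hzf, map_smul, hzf]
      exact hzlab a
  let R : LinearMap.ker G →ₗ[E] 𝔅.labelFilD ρ₁ τ i :=
    { toFun := fun x => ⟨rB ((x : 𝔅.labelFilD ρ τ i) : M ⊗[P] 𝔅.B), hker x⟩
      map_add' := fun x y => Subtype.ext (by
        simp only [Submodule.coe_add, map_add])
      map_smul' := fun c x => Subtype.ext (by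
        simp only [Submodule.coe_smul, map_smul, RingHom.id_apply]) }
  have hRinj : Function.Injective R := by
    intro x y hxy
    have h' : rB ((x : 𝔅.labelFilD ρ τ i) : M ⊗[P] 𝔅.B) = rB ((y : 𝔅.labelFilD ρ τ i) : M ⊗[P] 𝔅.B) :=
      congrArg Subtype.val hxy
    have hgx : gB ((x : 𝔅.labelFilD ρ τ i) : M ⊗[P] 𝔅.B) = 0 :=
      congrArg Subtype.val (LinearMap.mem_ker.1 x.2)
    have hgy : gB ((y : 𝔅.labelFilD ρ τ i) : M ⊗[P] 𝔅.B) = 0 :=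
      congrArg Subtype.val (LinearMap.mem_ker.1 y.2)
    have hx := hsumB ((x : 𝔅.labelFilD ρ τ i) : M ⊗[P] 𝔅.B)
    have hy := hsumB ((y : 𝔅.labelFilD ρ τ i) : M ⊗[P] 𝔅.B)
    rw [hgx, map_zero, add_zero] at hx
    rw [hgy, map_zero, add_zero] at hy
    apply Subtype.ext
    apply Subtype.ext
    rw [← hx, ← hy, h']
  have h1 := LinearMap.finrank_range_add_finrank_ker G
  have h2 : Module.finrank E (LinearMap.range G) ≤ Module.finrank E (𝔅.labelFilD ρ₂ τ i) :=
    Submodule.finrank_le _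
  have h3 : Module.finrank E (LinearMap.ker G) ≤ Module.finrank E (𝔅.labelFilD ρ₁ τ i) :=
    LinearMap.finrank_le_finrank_of_injective hRinj
  omega

end LeftExact

/-! ### §3 Exactness on weights from left exactness and duality -/

section Exact

variable {Γ : Type u} [Group Γ] [TopologicalSpace Γ] {P : Type v} {F : Type v'} [Field P]
  [Field F] [Algebra P F]
  {E : Type*} [Field E] [Algebra P E] [TopologicalSpace E]
  {M₁ : Type*} [AddCommGroup M₁] [Module E M₁] [Module P M₁] [IsScalarTower P E M₁]
  [TopologicalSpace M₁]
  {M : Type*} [AddCommGroup M] [Module E M] [Module P M] [IsScalarTower P E M]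
  [TopologicalSpace M]
  {M₂ : Type*} [AddCommGroup M₂] [Module E M₂] [Module P M₂] [IsScalarTower P E M₂]
  [TopologicalSpace M₂]
  {M₁' : Type*} [AddCommGroup M₁'] [Module E M₁'] [Module P M₁'] [IsScalarTower P E M₁']
  [TopologicalSpace M₁']
  {M' : Type*} [AddCommGroup M'] [Module E M'] [Module P M'] [IsScalarTower P E M']
  [TopologicalSpace M']
  {M₂' : Type*} [AddCommGroup M₂'] [Module E M₂'] [Module P M₂'] [IsScalarTower P E M₂']
  [TopologicalSpace M₂']
  (𝔅 : PeriodRingData.{u, v, v', w} Γ P F) (ρ₁ : ContinuousRep Γ E M₁) (ρ : ContinuousRep Γ E M)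
  (ρ₂ : ContinuousRep Γ E M₂) (ρ₁' : ContinuousRep Γ E M₁') (ρ' : ContinuousRep Γ E M')
  (ρ₂' : ContinuousRep Γ E M₂')

/-- **`dim Fil^i D_τ(V) = dim Fil^i D_τ(V₁) + dim Fil^i D_τ(V₂)` for a short exact sequence whose dual
sequence is also given**: `(f, g; r, s)` exact data for `V₁ → V → V₂`, `(f', g'; r', s')` exact data
for `V₂' → V' → V₁'` (e.g. the contragredients), `HT_τ(V') = −HT_τ(V)`, `HT_τ(Vᵢ') = −HT_τ(Vᵢ)`, and
`dim D_τ(V) = dim D_τ(V₁) + dim D_τ(V₂)` (Fontaine's count in the admissible case).  Left exactness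
for the first triple at `i` and for the second at `1 - i` give opposite inequalities (duality count).
[cite: FontaineAsterisque223III, Exp. III §1.5, Prop. 1.5.2] [cite: BrinonConrad2009, §6.3] -/
theorem finrank_labelFilD_eq_add_of_exact_of_dual (f : M₁ →ₗ[E] M) (g : M →ₗ[E] M₂)
    (r : M →ₗ[E] M₁) (s : M₂ →ₗ[E] M)
    (hf : ∀ (σ : Γ) (y : M₁), f (ρ₁ σ y) = ρ σ (f y))
    (hg : ∀ (σ : Γ) (x : M), g (ρ σ x) = ρ₂ σ (g x))
    (hrf : ∀ y, r (f y) = y) (hsum : ∀ x, f (r x) + s (g x) = x)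
    (f' : M₂' →ₗ[E] M') (g' : M' →ₗ[E] M₁') (r' : M' →ₗ[E] M₂') (s' : M₁' →ₗ[E] M')
    (hf' : ∀ (σ : Γ) (y : M₂'), f' (ρ₂' σ y) = ρ' σ (f' y))
    (hg' : ∀ (σ : Γ) (x : M'), g' (ρ' σ x) = ρ₁' σ (g' x))
    (hrf' : ∀ y, r' (f' y) = y) (hsum' : ∀ x, f' (r' x) + s' (g' x) = x)
    (τ : F →+* E) [FiniteDimensional E (𝔅.labelD ρ τ)]
    [FiniteDimensional E (𝔅.labelD ρ₁ τ)] [FiniteDimensional E (𝔅.labelD ρ₂ τ)]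
    [FiniteDimensional E (𝔅.labelD ρ' τ)]
    [FiniteDimensional E (𝔅.labelD ρ₁' τ)] [FiniteDimensional E (𝔅.labelD ρ₂' τ)]
    (hD : Module.finrank E (𝔅.labelD ρ τ) =
      Module.finrank E (𝔅.labelD ρ₁ τ) + Module.finrank E (𝔅.labelD ρ₂ τ))
    (hneg : 𝔅.labelledHodgeTateWeights ρ' τ = (𝔅.labelledHodgeTateWeights ρ τ).map fun h => -h)
    (hneg₁ : 𝔅.labelledHodgeTateWeights ρ₁' τ = (𝔅.labelledHodgeTateWeights ρ₁ τ).map fun h => -h)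
    (hneg₂ : 𝔅.labelledHodgeTateWeights ρ₂' τ = (𝔅.labelledHodgeTateWeights ρ₂ τ).map fun h => -h)
    (i : ℤ) :
    Module.finrank E (𝔅.labelFilD ρ τ i) =
      Module.finrank E (𝔅.labelFilD ρ₁ τ i) + Module.finrank E (𝔅.labelFilD ρ₂ τ i) := by
  have hle := 𝔅.finrank_labelFilD_le_add_of_exact ρ₁ ρ ρ₂ f g r s hf hg hrf hsum τ i
  have hle' := 𝔅.finrank_labelFilD_le_add_of_exact ρ₂' ρ' ρ₁' f' g' r' s' hf' hg' hrf' hsum' τ (1 - i)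
  have hc := 𝔅.finrank_labelFilD_add_finrank_labelFilD_of_eq_map_neg ρ ρ' τ hneg i
  have hc₁ := 𝔅.finrank_labelFilD_add_finrank_labelFilD_of_eq_map_neg ρ₁ ρ₁' τ hneg₁ i
  have hc₂ := 𝔅.finrank_labelFilD_add_finrank_labelFilD_of_eq_map_neg ρ₂ ρ₂' τ hneg₂ i
  omega

/-- **`HT_τ(V) = HT_τ(V₁) + HT_τ(V₂)` (multiset sum) for a short exact sequence of representations
whose contragredient sequence has negated weights** — hypotheses as in
`finrank_labelFilD_eq_add_of_exact_of_dual`.  For `B_dR` and de Rham `V` this is the exactness of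
`D_dR` with strict morphisms, read on `τ`-components.
[cite: FontaineAsterisque223III, Exp. III §1.5, Prop. 1.5.2] [cite: BrinonConrad2009, §6.3] [cite: Patrikis2019, §2.3.1] -/
theorem labelledHodgeTateWeights_eq_add_of_exact_of_dual (f : M₁ →ₗ[E] M) (g : M →ₗ[E] M₂)
    (r : M →ₗ[E] M₁) (s : M₂ →ₗ[E] M)
    (hf : ∀ (σ : Γ) (y : M₁), f (ρ₁ σ y) = ρ σ (f y))
    (hg : ∀ (σ : Γ) (x : M), g (ρ σ x) = ρ₂ σ (g x))
    (hrf : ∀ y, r (f y) = y) (hsum : ∀ x, f (r x) + s (g x) = x)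
    (f' : M₂' →ₗ[E] M') (g' : M' →ₗ[E] M₁') (r' : M' →ₗ[E] M₂') (s' : M₁' →ₗ[E] M')
    (hf' : ∀ (σ : Γ) (y : M₂'), f' (ρ₂' σ y) = ρ' σ (f' y))
    (hg' : ∀ (σ : Γ) (x : M'), g' (ρ' σ x) = ρ₁' σ (g' x))
    (hrf' : ∀ y, r' (f' y) = y) (hsum' : ∀ x, f' (r' x) + s' (g' x) = x)
    (τ : F →+* E) [FiniteDimensional E (𝔅.labelD ρ τ)]
    [FiniteDimensional E (𝔅.labelD ρ₁ τ)] [FiniteDimensional E (𝔅.labelD ρ₂ τ)]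
    [FiniteDimensional E (𝔅.labelD ρ' τ)]
    [FiniteDimensional E (𝔅.labelD ρ₁' τ)] [FiniteDimensional E (𝔅.labelD ρ₂' τ)]
    (hD : Module.finrank E (𝔅.labelD ρ τ) =
      Module.finrank E (𝔅.labelD ρ₁ τ) + Module.finrank E (𝔅.labelD ρ₂ τ))
    (hneg : 𝔅.labelledHodgeTateWeights ρ' τ = (𝔅.labelledHodgeTateWeights ρ τ).map fun h => -h)
    (hneg₁ : 𝔅.labelledHodgeTateWeights ρ₁' τ = (𝔅.labelledHodgeTateWeights ρ₁ τ).map fun h => -h)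
    (hneg₂ : 𝔅.labelledHodgeTateWeights ρ₂' τ = (𝔅.labelledHodgeTateWeights ρ₂ τ).map fun h => -h) :
    𝔅.labelledHodgeTateWeights ρ τ =
      𝔅.labelledHodgeTateWeights ρ₁ τ + 𝔅.labelledHodgeTateWeights ρ₂ τ := by
  haveI : ∀ j, FiniteDimensional E (𝔅.labelFilD ρ₁ τ j) := fun j =>
    Submodule.finiteDimensional_of_le (𝔅.labelFilD_le ρ₁ τ j)
  haveI : ∀ j, FiniteDimensional E (𝔅.labelFilD ρ₂ τ j) := fun j =>
    Submodule.finiteDimensional_of_le (𝔅.labelFilD_le ρ₂ τ j)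
  have hd : (fun i => Module.finrank E (𝔅.labelFilD ρ τ i)) =
      (fun i => Module.finrank E (𝔅.labelFilD ρ₁ τ i)) +
        fun i => Module.finrank E (𝔅.labelFilD ρ₂ τ i) := by
    funext i
    rw [Pi.add_apply]
    exact 𝔅.finrank_labelFilD_eq_add_of_exact_of_dual ρ₁ ρ ρ₂ ρ₁' ρ' ρ₂' f g r s hf hg hrf hsum
      f' g' r' s' hf' hg' hrf' hsum' τ hD hneg hneg₁ hneg₂ i
  have hanti₁ : Antitone fun i => Module.finrank E (𝔅.labelFilD ρ₁ τ i) := fun a b hab =>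
    Submodule.finrank_mono (𝔅.labelFilD_antitone ρ₁ τ hab)
  have hanti₂ : Antitone fun i => Module.finrank E (𝔅.labelFilD ρ₂ τ i) := fun a b hab =>
    Submodule.finrank_mono (𝔅.labelFilD_antitone ρ₂ τ hab)
  rw [labelledHodgeTateWeights_def, hd, labelledHodgeTateWeights_def, labelledHodgeTateWeights_def,
    jumpMultiset_add hanti₁ hanti₂
      (jumps_finite_of_antitone_of_le hanti₁
        (fun j => Submodule.finrank_mono (𝔅.labelFilD_le ρ₁ τ j)))
      (jumps_finite_of_antitone_of_le hanti₂
        (fun j => Submodule.finrank_mono (𝔅.labelFilD_le ρ₂ τ j)))]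

end Exact

/-! ### §4 Framed block-triangular representations -/

section Framed

variable {Γ : Type u} [Group Γ] [TopologicalSpace Γ] {P : Type v} {F : Type v'} [Field P]
  [Field F] [Algebra P F]
  {E : Type*} [Field E] [Algebra P E] [TopologicalSpace E] [IsTopologicalRing E]
  (𝔅 : PeriodRingData.{u, v, v', w} Γ P F)

omit [IsTopologicalRing E] in
/-- **The contragredient of a block upper-triangular framed representation is block lower-triangular**
with diagonal blocks the contragredients: if `ρ(g) = reindex (fromBlocks ρ₁(g) X(g) 0 ρ₂(g))` then
`ρ^∨(g) = reindex (fromBlocks ρ₁^∨(g) 0 X(g⁻¹)ᵀ ρ₂^∨(g))` (`ρ^∨(g) = ρ(g⁻¹)ᵀ`).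
[cite: FontaineAsterisque223III, Exp. III §1.5, Prop. 1.5.2] -/
theorem _root_.Literature.NumberTheory.GaloisRepresentations.FramedRep.coe_dual_apply_of_blockTriangular
    {m n : ℕ} (ρ : FramedRep Γ E (m + n)) (ρ₁ : FramedRep Γ E m) (ρ₂ : FramedRep Γ E n)
    (X : Γ → Matrix (Fin m) (Fin n) E)
    (hρ : ∀ g, ((ρ g : GL (Fin (m + n)) E) : Matrix (Fin (m + n)) (Fin (m + n)) E) =
      Matrix.reindex finSumFinEquiv finSumFinEquiv
        (Matrix.fromBlocks ((ρ₁ g : GL (Fin m) E) : Matrix (Fin m) (Fin m) E) (X g) 0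
          ((ρ₂ g : GL (Fin n) E) : Matrix (Fin n) (Fin n) E)))
    (g : Γ) :
    ((ρ.dual g : GL (Fin (m + n)) E) : Matrix (Fin (m + n)) (Fin (m + n)) E) =
      Matrix.reindex finSumFinEquiv finSumFinEquiv
        (Matrix.fromBlocks ((ρ₁.dual g : GL (Fin m) E) : Matrix (Fin m) (Fin m) E) 0 (X g⁻¹).transpose
          ((ρ₂.dual g : GL (Fin n) E) : Matrix (Fin n) (Fin n) E)) := by
  rw [FramedRep.coe_dual_apply, FramedRep.coe_dual_apply, FramedRep.coe_dual_apply, ← map_inv ρ g,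
    ← map_inv ρ₁ g, ← map_inv ρ₂ g, hρ g⁻¹, Matrix.transpose_reindex, Matrix.fromBlocks_transpose,
    Matrix.transpose_zero]

/-- **`HT_τ(ρ) = HT_τ(ρ₁) + HT_τ(ρ₂)` for a block upper-triangular framed `ρ : Γ →ₜ* GL_{m+n}(E)`**,
`ρ(g) = reindex (fromBlocks ρ₁(g) X(g) 0 ρ₂(g))` (`ρ₁` a subrepresentation on the first `m`
coordinates, `ρ₂` the quotient on the last `n`), for every period-ring datum `𝔅` and label
`τ : F → E`, granted: the six label components `D_τ(ρ), D_τ(ρᵢ), D_τ(ρ^∨), D_τ(ρᵢ^∨)` are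
finite-dimensional, `dim D_τ(ρ) = dim D_τ(ρ₁) + dim D_τ(ρ₂)` (Fontaine's count for admissible `ρ`), and
the contragredients have negated weights (accepted `PeriodRingData.labelledHodgeTateWeights_dual`) —
all automatic for de Rham `ρ` and `B_dR`.  Proof: `labelledHodgeTateWeights_eq_add_of_exact_of_dual`
for the coordinate inclusions/projections `E^m ⇄ E^{m+n} ⇄ E^n`, equivariant for `ρ` (upper shape)
and, in the opposite direction, for `ρ^∨` (lower shape, `coe_dual_apply_of_blockTriangular`).
[cite: FontaineAsterisque223III, Exp. III §1.5, Prop. 1.5.2] [cite: BrinonConrad2009, §6.3] [cite: Patrikis2019, §2.3.1] -/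
theorem labelledHodgeTateWeights_blockTriangular {m n : ℕ} (ρ : FramedRep Γ E (m + n))
    (ρ₁ : FramedRep Γ E m) (ρ₂ : FramedRep Γ E n) (X : Γ → Matrix (Fin m) (Fin n) E)
    (hρ : ∀ g, ((ρ g : GL (Fin (m + n)) E) : Matrix (Fin (m + n)) (Fin (m + n)) E) =
      Matrix.reindex finSumFinEquiv finSumFinEquiv
        (Matrix.fromBlocks ((ρ₁ g : GL (Fin m) E) : Matrix (Fin m) (Fin m) E) (X g) 0
          ((ρ₂ g : GL (Fin n) E) : Matrix (Fin n) (Fin n) E)))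
    (τ : F →+* E)
    [FiniteDimensional E (𝔅.labelD (FramedRep.toContinuousRep ρ) τ)]
    [FiniteDimensional E (𝔅.labelD (FramedRep.toContinuousRep ρ₁) τ)]
    [FiniteDimensional E (𝔅.labelD (FramedRep.toContinuousRep ρ₂) τ)]
    [FiniteDimensional E (𝔅.labelD (FramedRep.toContinuousRep ρ.dual) τ)]
    [FiniteDimensional E (𝔅.labelD (FramedRep.toContinuousRep ρ₁.dual) τ)]
    [FiniteDimensional E (𝔅.labelD (FramedRep.toContinuousRep ρ₂.dual) τ)]
    (hD : Module.finrank E (𝔅.labelD (FramedRep.toContinuousRep ρ) τ) =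
      Module.finrank E (𝔅.labelD (FramedRep.toContinuousRep ρ₁) τ) +
        Module.finrank E (𝔅.labelD (FramedRep.toContinuousRep ρ₂) τ))
    (hneg : 𝔅.labelledHodgeTateWeights (FramedRep.toContinuousRep ρ.dual) τ =
      (𝔅.labelledHodgeTateWeights (FramedRep.toContinuousRep ρ) τ).map fun h => -h)
    (hneg₁ : 𝔅.labelledHodgeTateWeights (FramedRep.toContinuousRep ρ₁.dual) τ =
      (𝔅.labelledHodgeTateWeights (FramedRep.toContinuousRep ρ₁) τ).map fun h => -h)
    (hneg₂ : 𝔅.labelledHodgeTateWeights (FramedRep.toContinuousRep ρ₂.dual) τ =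
      (𝔅.labelledHodgeTateWeights (FramedRep.toContinuousRep ρ₂) τ).map fun h => -h) :
    𝔅.labelledHodgeTateWeights (FramedRep.toContinuousRep ρ) τ =
      𝔅.labelledHodgeTateWeights (FramedRep.toContinuousRep ρ₁) τ +
        𝔅.labelledHodgeTateWeights (FramedRep.toContinuousRep ρ₂) τ := by
  -- the coordinate inclusions and projections `E^m ⇄ E^{m+n} ⇄ E^n`
  let ι₁ : (Fin m → E) →ₗ[E] (Fin (m + n) → E) :=
    { toFun := fun x j => Sum.elim x (0 : Fin n → E) (finSumFinEquiv.symm j)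
      map_add' := fun x y => by
        funext j
        simp only [Pi.add_apply]
        cases finSumFinEquiv.symm j <;> simp
      map_smul' := fun c x => by
        funext j
        simp only [Pi.smul_apply, RingHom.id_apply]
        cases finSumFinEquiv.symm j <;> simp }
  let ι₂ : (Fin n → E) →ₗ[E] (Fin (m + n) → E) :=
    { toFun := fun y j => Sum.elim (0 : Fin m → E) y (finSumFinEquiv.symm j)
      map_add' := fun x y => by
        funext j
        simp only [Pi.add_apply]
        cases finSumFinEquiv.symm j <;> simp
      map_smul' := fun c x => by
        funext j
        simp only [Pi.smul_apply, RingHom.id_apply]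
        cases finSumFinEquiv.symm j <;> simp }
  let π₁ : (Fin (m + n) → E) →ₗ[E] (Fin m → E) := LinearMap.funLeft E E (Fin.castAdd n)
  let π₂ : (Fin (m + n) → E) →ₗ[E] (Fin n → E) := LinearMap.funLeft E E (Fin.natAdd m)
  have hι₁c : ∀ (x : Fin m → E) (k : Fin m), ι₁ x (Fin.castAdd n k) = x k := fun x k => by
    change Sum.elim x (0 : Fin n → E) (finSumFinEquiv.symm (Fin.castAdd n k)) = x k
    rw [finSumFinEquiv_symm_apply_castAdd, Sum.elim_inl]
  have hι₁n : ∀ (x : Fin m → E) (k : Fin n), ι₁ x (Fin.natAdd m k) = 0 := fun x k => by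
    change Sum.elim x (0 : Fin n → E) (finSumFinEquiv.symm (Fin.natAdd m k)) = 0
    rw [finSumFinEquiv_symm_apply_natAdd, Sum.elim_inr, Pi.zero_apply]
  have hι₂c : ∀ (y : Fin n → E) (k : Fin m), ι₂ y (Fin.castAdd n k) = 0 := fun y k => by
    change Sum.elim (0 : Fin m → E) y (finSumFinEquiv.symm (Fin.castAdd n k)) = 0
    rw [finSumFinEquiv_symm_apply_castAdd, Sum.elim_inl, Pi.zero_apply]
  have hι₂n : ∀ (y : Fin n → E) (k : Fin n), ι₂ y (Fin.natAdd m k) = y k := fun y k => by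
    change Sum.elim (0 : Fin m → E) y (finSumFinEquiv.symm (Fin.natAdd m k)) = y k
    rw [finSumFinEquiv_symm_apply_natAdd, Sum.elim_inr]
  have hι₁c' : ∀ x : Fin m → E, (fun k => ι₁ x (Fin.castAdd n k)) = x := fun x => funext (hι₁c x)
  have hι₁n' : ∀ x : Fin m → E, (fun k => ι₁ x (Fin.natAdd m k)) = 0 := fun x => funext (hι₁n x)
  have hι₂c' : ∀ y : Fin n → E, (fun k => ι₂ y (Fin.castAdd n k)) = 0 := fun y => funext (hι₂c y)
  have hι₂n' : ∀ y : Fin n → E, (fun k => ι₂ y (Fin.natAdd m k)) = y := fun y => funext (hι₂n y)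
  have hπ₁ : ∀ (v : Fin (m + n) → E) (k : Fin m), π₁ v k = v (Fin.castAdd n k) := fun v k => rfl
  have hπ₂ : ∀ (v : Fin (m + n) → E) (k : Fin n), π₂ v k = v (Fin.natAdd m k) := fun v k => rfl
  -- the splitting identities
  have hrf : ∀ y, π₁ (ι₁ y) = y := fun y => funext fun k => by rw [hπ₁, hι₁c]
  have hrf' : ∀ y, π₂ (ι₂ y) = y := fun y => funext fun k => by rw [hπ₂, hι₂n]
  have hsum : ∀ x, ι₁ (π₁ x) + ι₂ (π₂ x) = x := fun x => by
    funext j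
    obtain ⟨s, rfl⟩ := finSumFinEquiv.surjective j
    rcases s with k | k
    · rw [finSumFinEquiv_apply_left, Pi.add_apply, hι₁c, hι₂c, hπ₁, add_zero]
    · rw [finSumFinEquiv_apply_right, Pi.add_apply, hι₁n, hι₂n, hπ₂, zero_add]
  have hsum' : ∀ x, ι₂ (π₂ x) + ι₁ (π₁ x) = x := fun x => (add_comm _ _).trans (hsum x)
  -- the entries of `ρ` and of `ρ^∨`
  have h₁₁ : ∀ g k l, ((ρ g : GL (Fin (m + n)) E) : Matrix (Fin (m + n)) (Fin (m + n)) E)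
      (Fin.castAdd n k) (Fin.castAdd n l) = ((ρ₁ g : GL (Fin m) E) : Matrix (Fin m) (Fin m) E) k l :=
    fun g k l => by
      rw [hρ g, Matrix.reindex_apply, Matrix.submatrix_apply, finSumFinEquiv_symm_apply_castAdd,
        finSumFinEquiv_symm_apply_castAdd, Matrix.fromBlocks_apply₁₁]
  have h₁₂ : ∀ g k l, ((ρ g : GL (Fin (m + n)) E) : Matrix (Fin (m + n)) (Fin (m + n)) E)
      (Fin.castAdd n k) (Fin.natAdd m l) = X g k l :=
    fun g k l => by
      rw [hρ g, Matrix.reindex_apply, Matrix.submatrix_apply, finSumFinEquiv_symm_apply_castAdd,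
        finSumFinEquiv_symm_apply_natAdd, Matrix.fromBlocks_apply₁₂]
  have h₂₁ : ∀ g k l, ((ρ g : GL (Fin (m + n)) E) : Matrix (Fin (m + n)) (Fin (m + n)) E)
      (Fin.natAdd m k) (Fin.castAdd n l) = 0 :=
    fun g k l => by
      rw [hρ g, Matrix.reindex_apply, Matrix.submatrix_apply, finSumFinEquiv_symm_apply_natAdd,
        finSumFinEquiv_symm_apply_castAdd, Matrix.fromBlocks_apply₂₁, Matrix.zero_apply]
  have h₂₂ : ∀ g k l, ((ρ g : GL (Fin (m + n)) E) : Matrix (Fin (m + n)) (Fin (m + n)) E)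
      (Fin.natAdd m k) (Fin.natAdd m l) = ((ρ₂ g : GL (Fin n) E) : Matrix (Fin n) (Fin n) E) k l :=
    fun g k l => by
      rw [hρ g, Matrix.reindex_apply, Matrix.submatrix_apply, finSumFinEquiv_symm_apply_natAdd,
        finSumFinEquiv_symm_apply_natAdd, Matrix.fromBlocks_apply₂₂]
  have d₁₁ : ∀ g k l, ((ρ.dual g : GL (Fin (m + n)) E) : Matrix (Fin (m + n)) (Fin (m + n)) E)
      (Fin.castAdd n k) (Fin.castAdd n l) =
        ((ρ₁.dual g : GL (Fin m) E) : Matrix (Fin m) (Fin m) E) k l := fun g k l => by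
    rw [FramedRep.coe_dual_apply, FramedRep.coe_dual_apply, ← map_inv ρ g, ← map_inv ρ₁ g,
      Matrix.transpose_apply, Matrix.transpose_apply, h₁₁]
  have d₁₂ : ∀ g k l, ((ρ.dual g : GL (Fin (m + n)) E) : Matrix (Fin (m + n)) (Fin (m + n)) E)
      (Fin.castAdd n k) (Fin.natAdd m l) = 0 := fun g k l => by
    rw [FramedRep.coe_dual_apply, ← map_inv ρ g, Matrix.transpose_apply, h₂₁]
  have d₂₁ : ∀ g k l, ((ρ.dual g : GL (Fin (m + n)) E) : Matrix (Fin (m + n)) (Fin (m + n)) E)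
      (Fin.natAdd m k) (Fin.castAdd n l) = X g⁻¹ l k := fun g k l => by
    rw [FramedRep.coe_dual_apply, ← map_inv ρ g, Matrix.transpose_apply, h₁₂]
  have d₂₂ : ∀ g k l, ((ρ.dual g : GL (Fin (m + n)) E) : Matrix (Fin (m + n)) (Fin (m + n)) E)
      (Fin.natAdd m k) (Fin.natAdd m l) =
        ((ρ₂.dual g : GL (Fin n) E) : Matrix (Fin n) (Fin n) E) k l := fun g k l => by
    rw [FramedRep.coe_dual_apply, FramedRep.coe_dual_apply, ← map_inv ρ g, ← map_inv ρ₂ g,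
      Matrix.transpose_apply, Matrix.transpose_apply, h₂₂]
  -- `ρ(σ) v` and `ρ^∨(σ) v` in coordinates
  have hv₁ : ∀ (σ : Γ) (v : Fin (m + n) → E) (k : Fin m),
      Matrix.mulVec ((ρ σ : GL (Fin (m + n)) E) : Matrix (Fin (m + n)) (Fin (m + n)) E) v
          (Fin.castAdd n k) =
        Matrix.mulVec ((ρ₁ σ : GL (Fin m) E) : Matrix (Fin m) (Fin m) E)
            (fun l => v (Fin.castAdd n l)) k +
          Matrix.mulVec (X σ) (fun l => v (Fin.natAdd m l)) k := by
    intro σ v k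
    simp only [Matrix.mulVec, dotProduct, Fin.sum_univ_add, h₁₁, h₁₂]
  have hv₂ : ∀ (σ : Γ) (v : Fin (m + n) → E) (k : Fin n),
      Matrix.mulVec ((ρ σ : GL (Fin (m + n)) E) : Matrix (Fin (m + n)) (Fin (m + n)) E) v
          (Fin.natAdd m k) =
        Matrix.mulVec ((ρ₂ σ : GL (Fin n) E) : Matrix (Fin n) (Fin n) E)
          (fun l => v (Fin.natAdd m l)) k := by
    intro σ v k
    simp only [Matrix.mulVec, dotProduct, Fin.sum_univ_add, h₂₁, h₂₂, zero_mul,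
      Finset.sum_const_zero, zero_add]
  have hd₁ : ∀ (σ : Γ) (v : Fin (m + n) → E) (k : Fin m),
      Matrix.mulVec ((ρ.dual σ : GL (Fin (m + n)) E) : Matrix (Fin (m + n)) (Fin (m + n)) E) v
          (Fin.castAdd n k) =
        Matrix.mulVec ((ρ₁.dual σ : GL (Fin m) E) : Matrix (Fin m) (Fin m) E)
          (fun l => v (Fin.castAdd n l)) k := by
    intro σ v k
    simp only [Matrix.mulVec, dotProduct, Fin.sum_univ_add, d₁₁, d₁₂, zero_mul,
      Finset.sum_const_zero, add_zero]
  have hd₂ : ∀ (σ : Γ) (v : Fin (m + n) → E) (k : Fin n),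
      Matrix.mulVec ((ρ.dual σ : GL (Fin (m + n)) E) : Matrix (Fin (m + n)) (Fin (m + n)) E) v
          (Fin.natAdd m k) =
        Matrix.mulVec (X σ⁻¹).transpose (fun l => v (Fin.castAdd n l)) k +
          Matrix.mulVec ((ρ₂.dual σ : GL (Fin n) E) : Matrix (Fin n) (Fin n) E)
            (fun l => v (Fin.natAdd m l)) k := by
    intro σ v k
    simp only [Matrix.mulVec, dotProduct, Fin.sum_univ_add, d₂₁, d₂₂, Matrix.transpose_apply]
  -- equivariance of the four structure maps
  have hf : ∀ (σ : Γ) (y : Fin m → E),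
      ι₁ (FramedRep.toContinuousRep ρ₁ σ y) = FramedRep.toContinuousRep ρ σ (ι₁ y) := by
    intro σ y
    rw [FramedRep.toContinuousRep_apply_apply, FramedRep.toContinuousRep_apply_apply]
    funext j
    obtain ⟨s, rfl⟩ := finSumFinEquiv.surjective j
    rcases s with k | k
    · rw [finSumFinEquiv_apply_left, hι₁c, hv₁, hι₁c', hι₁n', Matrix.mulVec_zero, Pi.zero_apply,
        add_zero]
    · rw [finSumFinEquiv_apply_right, hι₁n, hv₂, hι₁n', Matrix.mulVec_zero, Pi.zero_apply]
  have hg : ∀ (σ : Γ) (v : Fin (m + n) → E),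
      π₂ (FramedRep.toContinuousRep ρ σ v) = FramedRep.toContinuousRep ρ₂ σ (π₂ v) := by
    intro σ v
    rw [FramedRep.toContinuousRep_apply_apply, FramedRep.toContinuousRep_apply_apply]
    funext k
    rw [hπ₂, hv₂]
    rfl
  have hf' : ∀ (σ : Γ) (y : Fin n → E),
      ι₂ (FramedRep.toContinuousRep ρ₂.dual σ y) = FramedRep.toContinuousRep ρ.dual σ (ι₂ y) := by
    intro σ y
    rw [FramedRep.toContinuousRep_apply_apply, FramedRep.toContinuousRep_apply_apply]
    funext j
    obtain ⟨s, rfl⟩ := finSumFinEquiv.surjective j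
    rcases s with k | k
    · rw [finSumFinEquiv_apply_left, hι₂c, hd₁, hι₂c', Matrix.mulVec_zero, Pi.zero_apply]
    · rw [finSumFinEquiv_apply_right, hι₂n, hd₂, hι₂c', hι₂n', Matrix.mulVec_zero, Pi.zero_apply,
        zero_add]
  have hg' : ∀ (σ : Γ) (v : Fin (m + n) → E),
      π₁ (FramedRep.toContinuousRep ρ.dual σ v) = FramedRep.toContinuousRep ρ₁.dual σ (π₁ v) := by
    intro σ v
    rw [FramedRep.toContinuousRep_apply_apply, FramedRep.toContinuousRep_apply_apply]
    funext k
    rw [hπ₁, hd₁]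
    rfl
  exact 𝔅.labelledHodgeTateWeights_eq_add_of_exact_of_dual (FramedRep.toContinuousRep ρ₁)
    (FramedRep.toContinuousRep ρ) (FramedRep.toContinuousRep ρ₂) (FramedRep.toContinuousRep ρ₁.dual)
    (FramedRep.toContinuousRep ρ.dual) (FramedRep.toContinuousRep ρ₂.dual) ι₁ π₂ π₁ ι₂ hf hg hrf hsum
    ι₂ π₁ π₂ ι₁ hf' hg' hrf' hsum' τ hD hneg hneg₁ hneg₂

end Framed

end PeriodRingData

end Literature.NumberTheory.GaloisRepresentations

end
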